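import Literature.NumberTheory.Weil1964.ArchUnitarySiegelEmbedding
import Literature.NumberTheory.Weil1964.ArchMetaplecticGaussMultiplier
import HarnessLib

/-!
# The `det^{1/2}` character of the metaplectic cover over `U(α, β)` at every real rank (Paul 1998 (1.2.1)–(1.2.2))

Topic `NumberTheory/Weil1964`; namespace `Literature.NumberTheory.Weil1964.UnitaryBall`.  KERNEL throughout
(definitions with bodies and proved theorems only; no records, no `sorry`).

THE RESULT.  For Folland's metaplectic elements `x ∈ Mp^𝓢(W)` (`MpS.IsMetaplectic`, `W = ℝ^{α⊕β} × ℝ^{α⊕β}`) lying over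
the standard embedding `toSp : U(α, β) → Sp(W)` of the tree (`KonnoKonno2007.RealDualPair.UForm.toSp`), the number
`θ(x) = C(x) · det d(G)` — Folland's vacuum coefficient `C(x) = ⟪h₀, x h₀⟫` times the determinant of the `β`-block of
`G = (a b; c d)`, `proj x = toSp G` — satisfies
* `θ(x)² = det G` (`detHalf_sq`), `|θ(x)| = 1`, `θ(−x) = −θ(x)` (genuine),
* `θ(xy) = θ(x) θ(y)` (`detHalf_mul`).
So `x ↦ θ(x)` identifies the inverse image of `toSp(U(α,β))` in the metaplectic two-fold cover `Mp₂(W)` with the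
`det^{1/2}`-cover `{(G, z) : z² = det G}` of `U(α, β)` — [Paul1998, §1.2 (1.2.1)–(1.2.2)] / [KashiwaraVergne1978, §3] for
the pair `(U(α,β), U(1))`, at EVERY real rank `min(|α|, |β|)` (the tree's `Paul1998/DetCoverCocycleRankOne`,
`MetaplecticDetCoverLifting` cover real rank `≤ 1`).  The packaging for the dual pair `(U(p,q), U(r,s))` (B08-1's
`CocycleSection`) is the sequel `Paul1998/DetCoverCocycle`.

THE PROOF (no `KAK`, no Fock-model vacuum character, no `π₁`).  Put
`N_x(Z) = n_x(Φ(Z)) · det(cZ + d) · ρ_G(Z)`, `ρ_G(Z) = (|det(a + bZᴴ)|/|det(cZ + d)|)^{1/2}`, where `n_x` is the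
vacuum-normalised Gaussian multiplier (`ArchMetaplecticGaussMultiplier`) and `Φ` the Cayley–Satake map of the bounded
domain `{1 − ZᴴZ ≻ 0}` into the Siegel half-space (`ArchUnitarySiegelDomain/Embedding`).  §1: the branch-free square of
`n_x` and the factorisation `j(toSp G, Φ Z) det(1 − iΦ(G·Z)) = conj det(a + bZᴴ) det(cZ + d) det(1 − iΦ Z)` give
`n_x(Φ Z)² = 1/(conj det(a + bZᴴ) · det(cZ + d))`, whence §2: `N_x(Z)² = det G` for ALL `Z` (`det G` is the phase of
`det(a + bZᴴ) det(cZ + d)`).  `N_x` is continuous on the (star-shaped) domain, so by the intermediate value theorem it is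
constant along every segment `[0, Z]`: `N_x(Z) = N_x(0) = θ(x)`.  §3: multiplicativity then follows from the cocycle
`n_{xy}(i1) = n_x(toSp(G′) ⋆ i1) n_y(i1)`, the equivariance `toSp(G′) ⋆ i1 = Φ(G′·0)`, the constancy at `Z = G′·0`, and the
block identity `d(GG′) = (c·(G′·0) + d) d′`.

## References

* [Paul1998] A. Paul, *Howe correspondence for real unitary groups*, J. Funct. Anal. 159 (1998), §1.2 (1.2.1)–(1.2.2).
* [KashiwaraVergne1978] M. Kashiwara, M. Vergne, *On the Segal–Shale–Weil representations and harmonic polynomials*,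
  Invent. Math. 44 (1978), §3.
* [Folland1989] G. B. Folland, *Harmonic Analysis in Phase Space*, Princeton UP 1989, §4.2 (4.36)–(4.38), §4.5 (4.65).
* [Lee2004] M. H. Lee, LNM 1845 (2004), §6.3; [Siegel1943] C. L. Siegel, Amer. J. Math. 65, §2.
-/

set_option autoImplicit false

noncomputable section

open Matrix Complex
open scoped ComplexOrder ComplexConjugate

namespace Literature.NumberTheory.Weil1964

open Literature.RepresentationTheory.KonnoKonno2007 Literature.RepresentationTheory.KonnoKonno2007.RealDualPair
open Literature.NumberTheory.Automorphic Literature.NumberTheory.Automorphic.UnitaryGroup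
open Literature.Analysis.SegalBargmann

namespace UnitaryBall

variable {α β : Type*} [Fintype α] [DecidableEq α] [Fintype β] [DecidableEq β]

/-! ## 1. The normalised Gaussian multiplier along the Siegel embedding -/

/-- **`n_x(Φ Z)² · conj(det(a + bZᴴ)) · det(cZ + d) = 1`** for a metaplectic `x` over `toSp G` and `Z` in the bounded
domain: the branch-free square `n² j det(1 − i(g⋆τ)) = det(1 − iτ)` of `ArchMetaplecticGaussMultiplier` combined with
the equivariance and the factorisation of `ArchUnitarySiegelEmbedding`. [cite: Folland1989, §4.5 Thm. (4.65); Lee2004, §6.3 (6.30)] -/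
theorem gaussMultN_Φ_sq {x : MpS (α ⊕ β)} (hx : MpS.IsMetaplectic x) {G : UForm α β}
    (hxG : MpS.proj x = UForm.toSp α β G) {Z : Matrix α β ℂ} (hZ : Z ∈ ball α β) :
    MpS.gaussMultN x (Φ Z) ^ 2 * (star (a G + b G * Zᴴ).det * (c G * Z + d G).det) = 1 := by
  have hτ := Φ_mem_siegelH hZ
  have h := ((MpS.isGaussCovariant_iff_isMetaplectic x).2 hx).gaussMultN_sq hτ
  rw [hxG, sact_toSp_Φ G hZ, mul_assoc, sJ_toSp_Φ G hZ, ← mul_assoc] at h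
  exact mul_right_cancel₀ (det_one_sub_I_smul_Φ_ne_zero hZ) (h.trans (one_mul _).symm)

/-! ## 2. The continuous square root of `det G` along the domain -/

/-- The positive scalar `ρ_G(Z) = (|det(a + bZᴴ)| / |det(cZ + d)|)^{1/2}`. [cite: Lee2004, §6.3 (6.30)] -/
def rho (G : UForm α β) (Z : Matrix α β ℂ) : ℝ := Real.sqrt (‖(a G + b G * Zᴴ).det‖ / ‖(c G * Z + d G).det‖)

/-- `ρ_G(Z)² = |det(a + bZᴴ)| / |det(cZ + d)|`. [cite: Lee2004, §6.3 (6.30)] -/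
theorem rho_sq (G : UForm α β) (Z : Matrix α β ℂ) : rho G Z ^ 2 = ‖(a G + b G * Zᴴ).det‖ / ‖(c G * Z + d G).det‖ :=
  Real.sq_sqrt (div_nonneg (norm_nonneg _) (norm_nonneg _))

/-- `ρ ≥ 0`. [cite: Lee2004, §6.3 (6.30)] -/
theorem rho_nonneg (G : UForm α β) (Z : Matrix α β ℂ) : 0 ≤ rho G Z := Real.sqrt_nonneg _

/-- **`ρ_G(0) = 1`** (`|det a| = |det d|`). [cite: MoeglinVignerasWaldspurger1987, Ch. 1 I.17] -/
theorem rho_zero (G : UForm α β) : rho G 0 = 1 := by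
  rw [rho, Matrix.conjTranspose_zero, Matrix.mul_zero, add_zero, Matrix.mul_zero, zero_add, norm_det_a_eq_norm_det_d,
    div_self (norm_ne_zero_iff.2 (det_d_ne_zero G)), Real.sqrt_one]

/-- **`ρ_G(G′·0) = 1`** (`|det a(GG′)| = |det d(GG′)|` and the product formulas for the blocks).
[cite: MoeglinVignerasWaldspurger1987, Ch. 1 I.17] -/
theorem rho_moebius_zero (G G' : UForm α β) : rho G (moebius G' 0) = 1 := by
  have ha' : ‖(a G').det‖ ≠ 0 := norm_ne_zero_iff.2 (det_a_ne_zero G')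
  have hd' : ‖(d G').det‖ ≠ 0 := norm_ne_zero_iff.2 (det_d_ne_zero G')
  have h1 : ‖(a G + b G * (moebius G' 0)ᴴ).det‖ = ‖(a (G * G')).det‖ / ‖(a G').det‖ := by
    rw [norm_det_a_mul, mul_div_cancel_right₀ _ ha']
  have h2 : ‖(c G * moebius G' 0 + d G).det‖ = ‖(d (G * G')).det‖ / ‖(d G').det‖ := by
    rw [norm_det_d_mul, mul_div_cancel_right₀ _ hd']
  have hdd : ‖(d (G * G')).det‖ ≠ 0 := norm_ne_zero_iff.2 (det_d_ne_zero _)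
  rw [rho, h1, h2, norm_det_a_eq_norm_det_d, norm_det_a_eq_norm_det_d, div_self (div_ne_zero hdd hd'), Real.sqrt_one]

/-- **The continuous square root** `N_x(Z) = n_x(Φ Z) · det(cZ + d) · ρ_G(Z)` of `det G` along the domain.
[cite: Folland1989, §4.5 Thm. (4.65); Lee2004, §6.3 (6.30)] -/
def Nfun (x : MpS (α ⊕ β)) (G : UForm α β) (Z : Matrix α β ℂ) : ℂ :=
  MpS.gaussMultN x (Φ Z) * (c G * Z + d G).det * (rho G Z : ℂ)

/-- **`N_x(0) = C(x) · det d`** (the vacuum coefficient times `det d`; `Φ(0) = i1`, `ρ(0) = 1`).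
[cite: Folland1989, §4.2 (4.36)] -/
theorem Nfun_zero (x : MpS (α ⊕ β)) (G : UForm α β) : Nfun x G 0 = MpS.vac x * (d G).det := by
  rw [Nfun, Φ_zero, MpS.gaussMultN_base, Matrix.mul_zero, zero_add, rho_zero, Complex.ofReal_one, mul_one]

/-- **`det G` is the phase of `det(a + bZᴴ) · det(cZ + d)`**: `det G · |det(a + bZᴴ)| · |det(cZ + d)| = det(a + bZᴴ) det(cZ + d)`.
[cite: Lee2004, §6.3 (6.30)] -/
theorem det_mat_mul_norms (G : UForm α β) {Z : Matrix α β ℂ} (hZ : Z ∈ ball α β) :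
    (mat G).det * (‖(a G + b G * Zᴴ).det‖ : ℂ) * (‖(c G * Z + d G).det‖ : ℂ) =
      (a G + b G * Zᴴ).det * (c G * Z + d G).det := by
  have h1 := det_mat_mul_re G hZ
  have h2 := norm_det_ab_mul_norm_det_cd G hZ
  have hk : (((1 - Zᴴ * Z).det).re : ℂ) ≠ 0 := Complex.ofReal_ne_zero.2 (det_frame_re_pos hZ).ne'
  have hk1 : (((1 - (moebius G Z)ᴴ * moebius G Z).det).re : ℂ) ≠ 0 :=
    Complex.ofReal_ne_zero.2 (det_frame_re_pos (moebius_mem G hZ)).ne'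
  have h2c : ((‖(a G + b G * Zᴴ).det‖ : ℂ)) * (‖(c G * Z + d G).det‖ : ℂ) *
      (((1 - (moebius G Z)ᴴ * moebius G Z).det).re : ℂ) = (((1 - Zᴴ * Z).det).re : ℂ) := by
    exact_mod_cast h2
  apply mul_right_cancel₀ hk1
  calc (mat G).det * (‖(a G + b G * Zᴴ).det‖ : ℂ) * (‖(c G * Z + d G).det‖ : ℂ) *
        (((1 - (moebius G Z)ᴴ * moebius G Z).det).re : ℂ)
      = (mat G).det * (((1 - Zᴴ * Z).det).re : ℂ) := by rw [← h2c]; ring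
    _ = (a G + b G * Zᴴ).det * (c G * Z + d G).det *
        (((1 - (moebius G Z)ᴴ * moebius G Z).det).re : ℂ) := by rw [h1]; ring

/-- **`N_x(Z)² = det G` on the domain.** [cite: Folland1989, §4.5 Thm. (4.65); Lee2004, §6.3 (6.30)] -/
theorem Nfun_sq {x : MpS (α ⊕ β)} (hx : MpS.IsMetaplectic x) {G : UForm α β}
    (hxG : MpS.proj x = UForm.toSp α β G) {Z : Matrix α β ℂ} (hZ : Z ∈ ball α β) :
    Nfun x G Z ^ 2 = (mat G).det := by
  set A := (a G + b G * Zᴴ).det with hA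
  set C := (c G * Z + d G).det with hC
  have hA0 : A ≠ 0 := det_ab_ne_zero G hZ
  have hC0 : C ≠ 0 := det_cd_ne_zero G hZ
  have hnA : (‖A‖ : ℂ) ≠ 0 := Complex.ofReal_ne_zero.2 (norm_ne_zero_iff.2 hA0)
  have hnC : (‖C‖ : ℂ) ≠ 0 := Complex.ofReal_ne_zero.2 (norm_ne_zero_iff.2 hC0)
  have h1 := gaussMultN_Φ_sq hx hxG hZ
  have h2 := det_mat_mul_norms G hZ
  have hρ : ((rho G Z : ℂ)) ^ 2 = (‖A‖ : ℂ) / (‖C‖ : ℂ) := by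
    rw [← Complex.ofReal_pow, rho_sq]; push_cast; rfl
  have hAA : star A * A = (‖A‖ : ℂ) ^ 2 := by rw [Complex.star_def, Complex.conj_mul']
  -- `N² = n² C² ρ² = C² ρ²/(Ā C) = C ‖A‖/(Ā ‖C‖)`, and `det G = A C/(‖A‖ ‖C‖)`; these agree since `‖A‖² = Ā A`.
  rw [Nfun, mul_pow, mul_pow, hρ]
  rw [← hA, ← hC] at h1 h2
  have hdet : (mat G).det = A * C / ((‖A‖ : ℂ) * (‖C‖ : ℂ)) := by
    rw [eq_div_iff (mul_ne_zero hnA hnC), ← h2, mul_assoc]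
  rw [hdet]
  have hn2 : MpS.gaussMultN x (Φ Z) ^ 2 = 1 / (star A * C) := by
    rw [eq_div_iff (mul_ne_zero (star_ne_zero.2 hA0) hC0), h1]
  rw [hn2, ← hC]
  field_simp
  rw [← hAA, mul_comm (star A) A, mul_div_cancel_right₀ _ (star_ne_zero.2 hA0)]

omit [DecidableEq α] in
/-- The bounded domain is star-shaped about `0`: `tZ ∈ 𝒟` for `0 ≤ t ≤ 1`. [cite: Lee2004, §6.3] -/
theorem smul_mem_ball {Z : Matrix α β ℂ} (hZ : Z ∈ ball α β) {t : ℝ} (ht0 : 0 ≤ t) (ht1 : t ≤ 1) :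
    ((t : ℂ) • Z) ∈ ball α β := by
  rw [mem_ball, Matrix.conjTranspose_smul, Matrix.smul_mul, Matrix.mul_smul, smul_smul, Complex.star_def,
    Complex.conj_ofReal]
  have h : (1 : Matrix β β ℂ) - ((t : ℂ) * (t : ℂ)) • (Zᴴ * Z) =
      (1 - Zᴴ * Z) + (((1 - t * t : ℝ) : ℂ)) • (Zᴴ * Z) := by
    push_cast
    rw [sub_smul, one_smul]
    abel
  rw [h]
  refine hZ.add_posSemidef ((Matrix.posSemidef_conjTranspose_mul_self Z).smul ?_)
  have : 0 ≤ 1 - t * t := by nlinarith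
  exact_mod_cast this

omit [Fintype α] [DecidableEq α] [Fintype β] [DecidableEq β] in
/-- `Z ↦ Ẑ` is continuous. [cite: Lee2004, §6.3] -/
theorem continuous_hatZ : Continuous (hatZ : Matrix α β ℂ → Matrix (α ⊕ β) (α ⊕ β) ℂ) := by
  unfold hatZ
  exact Continuous.matrix_fromBlocks continuous_const continuous_id continuous_id.matrix_transpose continuous_const

/-- `Φ` is continuous on the domain. [cite: Siegel1943, §2] -/
theorem continuousOn_Φ : ContinuousOn (Φ : Matrix α β ℂ → Matrix (α ⊕ β) (α ⊕ β) ℂ) (ball α β) := by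
  intro Z hZ
  have hN : ContinuousAt (fun W : Matrix α β ℂ => (1 + hatZ W)⁻¹) Z := by
    have h1 : ContinuousAt (fun W : Matrix α β ℂ => 1 + hatZ W) Z :=
      (continuous_const.add continuous_hatZ).continuousAt
    have h2 : ContinuousAt Inv.inv (1 + hatZ Z) := by
      refine continuousAt_matrix_inv _ ?_
      rw [Ring.inverse_eq_inv']
      exact continuousAt_inv₀ (det_one_add_hatZ_ne_zero hZ)
    exact ContinuousAt.comp (g := Inv.inv) h2 h1
  unfold Φ
  exact ((hN.const_smul (2 : ℂ)).sub continuousAt_const).const_smul I |>.continuousWithinAt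

/-- `ρ_G` is continuous on the domain. [cite: Lee2004, §6.3 (6.30)] -/
theorem continuousOn_rho (G : UForm α β) : ContinuousOn (rho G) (ball α β) := by
  have hA : Continuous fun Z : Matrix α β ℂ => ‖(a G + b G * Zᴴ).det‖ :=
    ((continuous_const.add (continuous_const.matrix_mul continuous_id.matrix_conjTranspose)).matrix_det).norm
  have hC : Continuous fun Z : Matrix α β ℂ => ‖(c G * Z + d G).det‖ :=
    (((continuous_const.matrix_mul continuous_id).add continuous_const).matrix_det).norm
  unfold rho
  exact Real.continuous_sqrt.comp_continuousOn
    (hA.continuousOn.div hC.continuousOn fun Z hZ => norm_ne_zero_iff.2 (det_cd_ne_zero G hZ))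

/-- **`N_x` is continuous on the domain** (the multiplier is continuous on `𝔥`, `Φ` maps the domain into `𝔥`).
[cite: Folland1989, §4.5 Thm. (4.65)] -/
theorem continuousOn_Nfun (x : MpS (α ⊕ β)) (G : UForm α β) : ContinuousOn (Nfun x G) (ball α β) := by
  have h1 : ContinuousOn (fun Z : Matrix α β ℂ => MpS.gaussMultN x (Φ Z)) (ball α β) :=
    (MpS.continuousOn_gaussMultN x).comp continuousOn_Φ fun Z hZ => Φ_mem_siegelH hZ
  have h2 : Continuous fun Z : Matrix α β ℂ => (c G * Z + d G).det :=
    ((continuous_const.matrix_mul continuous_id).add continuous_const).matrix_det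
  unfold Nfun
  exact (h1.mul h2.continuousOn).mul (Complex.continuous_ofReal.comp_continuousOn (continuousOn_rho G))

/-- A continuous function on `[0, 1]` with constant non-zero square is constant (intermediate value theorem).
[folklore] -/
private theorem eq_of_sq_eq_const {f : ℝ → ℂ} (hf : ContinuousOn f (Set.Icc 0 1)) {w : ℂ} (hw : w ≠ 0)
    (hsq : ∀ t ∈ Set.Icc (0 : ℝ) 1, f t ^ 2 = w) (h0 : f 0 ^ 2 = w) : f 1 = f 0 := by
  have hf0 : f 0 ≠ 0 := fun h => hw (by rw [← h0, h, zero_pow two_ne_zero])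
  have hpm : ∀ t ∈ Set.Icc (0 : ℝ) 1, f t / f 0 = 1 ∨ f t / f 0 = -1 := fun t ht => by
    rw [← sq_eq_one_iff, div_pow, hsq t ht, h0, div_self hw]
  by_contra hne
  have h1 : f 1 / f 0 = -1 := by
    rcases hpm 1 ⟨zero_le_one, le_rfl⟩ with h | h
    · exact absurd ((div_eq_one_iff_eq hf0).1 h) hne
    · exact h
  -- the real part of `f t / f 0` is continuous, `= 1` at `0`, `= −1` at `1`, and never `0`
  have hg : ContinuousOn (fun t => (f t / f 0).re) (Set.Icc 0 1) :=
    Complex.continuous_re.comp_continuousOn (hf.div continuousOn_const fun _ _ => hf0)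
  have hmem : (0 : ℝ) ∈ Set.Icc ((fun t => (f t / f 0).re) 1) ((fun t => (f t / f 0).re) 0) := by
    simp only [h1, div_self hf0, Complex.neg_re, Complex.one_re]
    norm_num
  obtain ⟨t, ht, ht0⟩ := intermediate_value_Icc' zero_le_one hg hmem
  have ht0' : (f t / f 0).re = 0 := ht0
  rcases hpm t ht with h | h
  · rw [h, Complex.one_re] at ht0'; exact one_ne_zero ht0'
  · rw [h, Complex.neg_re, Complex.one_re] at ht0'; norm_num at ht0'

/-- **`N_x` is constant on the domain**: `N_x(Z) = N_x(0)` (continuous with constant square `det G` along the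
segment `[0, Z]`). [cite: Folland1989, §4.5 Thm. (4.65)] -/
theorem Nfun_eq_Nfun_zero {x : MpS (α ⊕ β)} (hx : MpS.IsMetaplectic x) {G : UForm α β}
    (hxG : MpS.proj x = UForm.toSp α β G) {Z : Matrix α β ℂ} (hZ : Z ∈ ball α β) :
    Nfun x G Z = Nfun x G 0 := by
  set f : ℝ → ℂ := fun t => Nfun x G ((t : ℂ) • Z) with hf
  have hpath : ContinuousOn f (Set.Icc 0 1) := by
    refine (continuousOn_Nfun x G).comp ((Complex.continuous_ofReal.smul continuous_const).continuousOn) ?_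
    exact fun t ht => smul_mem_ball hZ ht.1 ht.2
  have hsq : ∀ t ∈ Set.Icc (0 : ℝ) 1, f t ^ 2 = (mat G).det := fun t ht =>
    Nfun_sq hx hxG (smul_mem_ball hZ ht.1 ht.2)
  have h0 : f 0 ^ 2 = (mat G).det := hsq 0 ⟨le_rfl, zero_le_one⟩
  have h := eq_of_sq_eq_const hpath (det_mat_ne_zero G) hsq h0
  simp only [hf, Complex.ofReal_one, one_smul, Complex.ofReal_zero, zero_smul] at h
  exact h

/-! ## 3. The genuine character `det^{1/2}` -/

/-- **The `det^{1/2}` value** of a metaplectic element `x` over `toSp G`: `θ(x) = C(x) · det d(G)` (vacuum coefficient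
times the determinant of the `β`-block). [cite: Paul1998, §1.2 (1.2.1)–(1.2.2); KashiwaraVergne1978, §3] -/
def detHalf (x : MpS (α ⊕ β)) (G : UForm α β) : ℂ := MpS.vac x * (d G).det

/-- **`θ(x)² = det G`.** [cite: Paul1998, §1.2 (1.2.1)–(1.2.2)] -/
theorem detHalf_sq {x : MpS (α ⊕ β)} (hx : MpS.IsMetaplectic x) {G : UForm α β}
    (hxG : MpS.proj x = UForm.toSp α β G) : detHalf x G ^ 2 = (mat G).det := by
  rw [detHalf, ← Nfun_zero, Nfun_sq hx hxG zero_mem_ball]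

/-- **`|θ(x)| = 1`.** [cite: Paul1998, §1.2 (1.2.2)] -/
theorem norm_detHalf {x : MpS (α ⊕ β)} (hx : MpS.IsMetaplectic x) {G : UForm α β}
    (hxG : MpS.proj x = UForm.toSp α β G) : ‖detHalf x G‖ = 1 := by
  have h := congrArg (fun z : ℂ => ‖z‖) (detHalf_sq hx hxG)
  simp only [norm_pow, norm_det_mat] at h
  exact (pow_eq_one_iff_of_nonneg (norm_nonneg _) two_ne_zero).1 h

/-- **`θ(−x) = −θ(x)`** — the character is genuine. [cite: Paul1998, §1.2 (1.2.2)] -/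
theorem detHalf_negOne_mul (x : MpS (α ⊕ β)) (G : UForm α β) :
    detHalf (MpS.negOne * x) G = -detHalf x G := by
  rw [detHalf, detHalf, MpS.vac_negOne_mul, neg_mul]

/-- **The normalised multiplier at `Φ(G′·0)`** in terms of `θ`: `n_x(Φ(G′·0)) · det(c(G′·0) + d) = θ(x)`.
[cite: Folland1989, §4.5 Thm. (4.65)] -/
theorem gaussMultN_Φ_moebius_zero {x : MpS (α ⊕ β)} (hx : MpS.IsMetaplectic x) {G : UForm α β}
    (hxG : MpS.proj x = UForm.toSp α β G) (G' : UForm α β) :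
    MpS.gaussMultN x (Φ (moebius G' 0)) * (c G * moebius G' 0 + d G).det = detHalf x G := by
  have h := Nfun_eq_Nfun_zero hx hxG (moebius_mem G' zero_mem_ball)
  rwa [Nfun, rho_moebius_zero, Complex.ofReal_one, mul_one, Nfun_zero] at h

/-- **MULTIPLICATIVITY: `θ(xy) = θ(x) θ(y)`** for metaplectic `x` over `toSp G` and `y` over `toSp G′` — the cocycle of the
normalised Gaussian multiplier at the base point, the equivariance `toSp(G′) ⋆ i1 = Φ(G′·0)`, the constancy of `N_x`, and
`d(GG′) = (c·(G′·0) + d) d′`. [cite: Paul1998, §1.2 (1.2.1)–(1.2.2); KashiwaraVergne1978, §3] -/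
theorem detHalf_mul {x y : MpS (α ⊕ β)} (hx : MpS.IsMetaplectic x) (hy : MpS.IsMetaplectic y) {G G' : UForm α β}
    (hxG : MpS.proj x = UForm.toSp α β G) (hyG : MpS.proj y = UForm.toSp α β G') :
    detHalf (x * y) (G * G') = detHalf x G * detHalf y G' := by
  have hcov := ((MpS.isGaussCovariant_iff_isMetaplectic x).2 hx).gaussMultN_mul
    ((MpS.isGaussCovariant_iff_isMetaplectic y).2 hy) (I_smul_one_mem_siegelH (σ := α ⊕ β))
  rw [hyG, ← Φ_zero, sact_toSp_Φ G' zero_mem_ball, Φ_zero, MpS.gaussMultN_base, MpS.gaussMultN_base] at hcov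
  have h3 := gaussMultN_Φ_moebius_zero hx hxG G'
  rw [detHalf] at h3
  rw [detHalf, hcov, d_mul, Matrix.det_mul, detHalf, detHalf]
  linear_combination (MpS.vac y * (d G').det) * h3

end UnitaryBall

end Literature.NumberTheory.Weil1964
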